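import Literature.NumberTheory.CubicFields.PureCubicLexMinFP
import Literature.NumberTheory.CubicFields.PureCubicLexMinCorrect
import Mathlib.NumberTheory.NumberField.Units.Regulator

/-!
# Crux `LinnikCubicClassGroups.PureCubicClassGroupFBQP` (stmt-QuantumAdvantage-11544) — stub `stub_cubicLexMinFP` (S3b-G2)

Line `arakelov-giant-step-cycle`, stub `stub_cubicLexMinFP` (S3b-G2): THE LATTICE PRIMITIVE OF THE
WALK. Given the reduction theory of a cubic field of signature `(1, 1)` (T3a′), the facts on the pure
cubic order `ℤ⟨1, θ, θ₂⟩` of `K = ℚ(θ)`, `θ³ = ab²` (B), the two rank-`3` lattice inputs (C: the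
enumeration box of an LLL-reduced basis and the sup-norm perturbation bounds) and the five lattice
programs on codes (G1), there is a typed polynomial-time program `lexE` on codes
`((a, b), (den, [h11, …, h33])) ↦ (x, y, z, den′)` which, on a canonical lattice code naming a
nonzero fractional ideal `I` of `K`, returns an element code of denominator `≥ 1` whose value is a
member of the code lying in the open unit cylinder `{σ₁ > 0, ‖σ₂‖ < 1}` and of LEAST real conjugate
`σ₁` there (the reducing element of the Buchmann–Williams giant step).

The witness is the concrete program `Literature.NumberTheory.CubicFields.PureCubicLexMin.lexE`
(`PureCubicLexMinProgram.lean`: rounded scaled embedding matrix at each dyadic scale, exact LLL of the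
integer approximation, enumeration of a coefficient box, exact norm-form filters, selection of the
least real conjugate); its polynomial-time realisation is `PureCubicLexMin.lexE_codeFP`
(`PureCubicLexMinFP.lean`) and its specification is `PureCubicLexMin.Correctness.lexE_correct`
(`PureCubicLexMinCorrect.lean`, assembling `PureCubicLexMinFound.lean` — the coordinate row of the
cylinder minimum is a candidate at its true scale — and `PureCubicLexMinRange.lean` — that scale is
scanned). Of the four hypotheses only C is consumed (T3a′ and B are used through their landed
Literature forms `VoronoiReduction.exists_cylinder_min`, `PureCubic.three_mul_mem_order` inside
`lexE_correct`; G1 is not needed); `PureCubicCodes.Canon/Mem/val` are definitionally the expanded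
clauses of the statement.
-/

set_option linter.dupNamespace false

namespace Summit.QuantumAdvantage.QuantumAdvantage.Theorems.LinnikCubicClassGroups

open scoped NumberField nonZeroDivisors
open Literature.Computability.Complexity (CodeFP)
open Literature.Computability.Complexity.CodeFP (pairE strE natE intE bitE unE rawE)
open Literature.NumberTheory.CubicFields (posRelMinima)
open Literature.Algebra.EuclideanLattices (IsLLLReduced)

/-- **`stub_cubicLexMinFPCore`** (the short registered handle of S3b-G2, hypotheses C only): the
concrete program `PureCubicLexMin.lexE` is typed polynomial time and meets the specification of the
least cylinder element on canonical lattice codes of nonzero fractional ideals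
(`lexE_codeFP`, `Correctness.lexE_correct`). -/
theorem stub_cubicLexMinFPCore :
    (∀ (b : Fin 3 → EuclideanSpace ℝ (Fin 3)), LinearIndependent ℝ b → IsLLLReduced (3 / 4) b →
      ∀ (m ρ : ℝ), 0 < m →
        (∀ c : Fin 3 → ℤ, c ≠ 0 → m ≤ ‖∑ i, (c i : ℝ) • b i‖) →
        ∀ c : Fin 3 → ℤ, ‖∑ i, (c i : ℝ) • b i‖ ≤ ρ → ∀ i, |(c i : ℝ)| ≤ 4 * ρ / m + 2) →
    (∀ (B B' : Matrix (Fin 3) (Fin 3) ℝ) (δ μ : ℝ), 0 ≤ δ → 0 < μ →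
      (∀ i j, |B i j - B' i j| ≤ δ) →
      (∀ v : Fin 3 → ℝ, μ * ‖v‖ ≤ ‖Matrix.vecMul v B‖) →
      3 * δ < μ →
      ∀ c : Fin 3 → ℤ,
        ‖Matrix.vecMul (fun i => (c i : ℝ)) B'‖ ≤ ‖Matrix.vecMul (fun i => (c i : ℝ)) B‖ * (1 + 3 * δ / μ) ∧
        ‖Matrix.vecMul (fun i => (c i : ℝ)) B‖ * (1 - 3 * δ / μ) ≤ ‖Matrix.vecMul (fun i => (c i : ℝ)) B'‖) →
    CodeFP (pairE (pairE natE natE) (pairE natE (rawE intE))) (pairE intE (pairE intE (pairE intE natE)))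
      Literature.NumberTheory.CubicFields.PureCubicLexMin.lexE ∧
    ∀ (a b : ℕ), Squarefree (a * b) → a * b ≠ 1 →
      ∀ (K : Type) [Field K] [NumberField K], Module.finrank ℚ K = 3 →
        ∀ θ : K, θ ^ 3 = ((a * b ^ 2 : ℕ) : K) →
        ∀ (σ₁ : K →+* ℝ) (σ₂ : K →+* ℂ), (∃ z : K, starRingEnd ℂ (σ₂ z) ≠ σ₂ z) →
        ∀ c : ℕ × List ℤ, Literature.NumberTheory.CubicFields.PureCubicCodes.Canon c →
          (∃ I : FractionalIdeal (𝓞 K)⁰ K, I ≠ 0 ∧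
            ∀ φ : K, Literature.NumberTheory.CubicFields.PureCubicCodes.Mem θ b c φ ↔ φ ∈ I) →
          1 ≤ (Literature.NumberTheory.CubicFields.PureCubicLexMin.lexE ((a, b), c)).2.2.2 ∧
          Literature.NumberTheory.CubicFields.PureCubicCodes.Mem θ b c
            (Literature.NumberTheory.CubicFields.PureCubicCodes.val θ b
              (Literature.NumberTheory.CubicFields.PureCubicLexMin.lexE ((a, b), c))) ∧
          0 < σ₁ (Literature.NumberTheory.CubicFields.PureCubicCodes.val θ b
            (Literature.NumberTheory.CubicFields.PureCubicLexMin.lexE ((a, b), c))) ∧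
          ‖σ₂ (Literature.NumberTheory.CubicFields.PureCubicCodes.val θ b
            (Literature.NumberTheory.CubicFields.PureCubicLexMin.lexE ((a, b), c)))‖ < 1 ∧
          ∀ φ : K, Literature.NumberTheory.CubicFields.PureCubicCodes.Mem θ b c φ → 0 < σ₁ φ → ‖σ₂ φ‖ < 1 →
            σ₁ (Literature.NumberTheory.CubicFields.PureCubicCodes.val θ b
              (Literature.NumberTheory.CubicFields.PureCubicLexMin.lexE ((a, b), c))) ≤ σ₁ φ := by
  intro hC1 hC2
  refine ⟨Literature.NumberTheory.CubicFields.PureCubicLexMin.lexE_codeFP, ?_⟩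
  intro a b hab hab1 K _ _ hdeg θ hθ σ₁ σ₂ hσ₂ c hc hI
  obtain ⟨I, hI0, hI⟩ := hI
  exact Literature.NumberTheory.CubicFields.PureCubicLexMin.Correctness.lexE_correct hC1 hC2 σ₁ σ₂ hdeg hab hab1
    hθ hσ₂ hc hI0 hI

/-- **S3b-G2 `stub_cubicLexMinFP`: the least cylinder element of a lattice, in typed polynomial
time.** Under the hypotheses T3a′ (reduction theory), B (the pure cubic order), C (rank-`3` LLL box
and perturbation) and G1 (the lattice programs), there is a `CodeFP` program `lexE` which on a
canonical lattice code `c` of a nonzero fractional ideal of `ℚ(θ)`, `θ³ = ab²`, returns an element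
code of denominator `≥ 1`, a member of `c`, in the unit cylinder `{σ₁ > 0, ‖σ₂‖ < 1}` and of least
`σ₁` there; witnessed by `PureCubicLexMin.lexE` (`lexE_codeFP`, `Correctness.lexE_correct`). -/
theorem stub_cubicLexMinFP :
    (∀ (K : Type) [Field K] [NumberField K], Module.finrank ℚ K = 3 →
    ∀ (σ₁ : K →+* ℝ) (σ₂ : K →+* ℂ), (∃ z : K, starRingEnd ℂ (σ₂ z) ≠ σ₂ z) →
      (∀ (I : FractionalIdeal (𝓞 K)⁰ K), I ≠ 0 →
        ∃ γ : K, γ ∈ I ∧ 0 < σ₁ γ ∧ ‖σ₂ γ‖ < 1 ∧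
          (∀ φ : K, φ ∈ I → 0 < σ₁ φ → ‖σ₂ φ‖ < 1 → σ₁ γ ≤ σ₁ φ) ∧
          (∀ φ : K, φ ∈ I → 0 < σ₁ φ → ‖σ₂ φ‖ < 1 → σ₁ φ ≤ σ₁ γ → φ = γ) ∧
          γ ∈ posRelMinima σ₁ σ₂ I ∧
          (FractionalIdeal.absNorm I : ℝ) < σ₁ γ ∧
          σ₁ γ ≤ 3 * (FractionalIdeal.absNorm I : ℝ) * Real.sqrt |(NumberField.discr K : ℝ)|) ∧
      (∀ (I : FractionalIdeal (𝓞 K)⁰ K) (θ : K), θ ∈ posRelMinima σ₁ σ₂ I →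
        (1 : K) ∈ posRelMinima σ₁ σ₂ (FractionalIdeal.spanSingleton (𝓞 K)⁰ θ⁻¹ * I)) ∧
      (∀ (J : FractionalIdeal (𝓞 K)⁰ K), (1 : K) ∈ posRelMinima σ₁ σ₂ J →
        1 ≤ J ∧ (FractionalIdeal.absNorm J : ℝ) ≤ 1 ∧
          Real.pi / (2 * Real.sqrt |(NumberField.discr K : ℝ)|) ≤ (FractionalIdeal.absNorm J : ℝ)) ∧
      NumberField.Units.regulator K ≤ |(NumberField.discr K : ℝ)| ^ 6) →
    (∀ (a b : ℕ), Squarefree (a * b) → a * b ≠ 1 →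
      ∀ (K : Type) [Field K] [NumberField K], Module.finrank ℚ K = 3 →
        ∀ θ : K, θ ^ 3 = ((a * b ^ 2 : ℕ) : K) →
          IsIntegral ℤ θ ∧ IsIntegral ℤ (θ ^ 2 / (b : K)) ∧
          (∀ ξ : 𝓞 K, ∃ c₀ c₁ c₂ : ℤ, (3 : K) * (ξ : K) = c₀ + c₁ * θ + c₂ * (θ ^ 2 / (b : K))) ∧
          (∀ c₀ c₁ c₂ : ℚ, (c₀ : K) + (c₁ : K) * θ + (c₂ : K) * (θ ^ 2 / (b : K)) = 0 → c₀ = 0 ∧ c₁ = 0 ∧ c₂ = 0) ∧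
          (∀ x y z : ℚ, Algebra.norm ℚ ((x : K) + (y : K) * θ + (z : K) * (θ ^ 2 / (b : K))) =
            x ^ 3 + (a * b ^ 2 : ℕ) * y ^ 3 + (a ^ 2 * b : ℕ) * z ^ 3 - 3 * (a * b : ℕ) * x * y * z) ∧
          (∀ x y z : ℚ, Algebra.trace ℚ K ((x : K) + (y : K) * θ + (z : K) * (θ ^ 2 / (b : K))) = 3 * x)) →
    ((∀ (b : Fin 3 → EuclideanSpace ℝ (Fin 3)), LinearIndependent ℝ b → IsLLLReduced (3 / 4) b →
      ∀ (m ρ : ℝ), 0 < m →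
        (∀ c : Fin 3 → ℤ, c ≠ 0 → m ≤ ‖∑ i, (c i : ℝ) • b i‖) →
        ∀ c : Fin 3 → ℤ, ‖∑ i, (c i : ℝ) • b i‖ ≤ ρ → ∀ i, |(c i : ℝ)| ≤ 4 * ρ / m + 2) ∧
    (∀ (B B' : Matrix (Fin 3) (Fin 3) ℝ) (δ μ : ℝ), 0 ≤ δ → 0 < μ →
      (∀ i j, |B i j - B' i j| ≤ δ) →
      (∀ v : Fin 3 → ℝ, μ * ‖v‖ ≤ ‖Matrix.vecMul v B‖) →
      3 * δ < μ →
      ∀ c : Fin 3 → ℤ,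
        ‖Matrix.vecMul (fun i => (c i : ℝ)) B'‖ ≤ ‖Matrix.vecMul (fun i => (c i : ℝ)) B‖ * (1 + 3 * δ / μ) ∧
        ‖Matrix.vecMul (fun i => (c i : ℝ)) B‖ * (1 - 3 * δ / μ) ≤ ‖Matrix.vecMul (fun i => (c i : ℝ)) B'‖)) →
    (∃ (mulE : (ℕ × ℕ) × ((ℤ × ℤ × ℤ × ℕ) × (ℤ × ℤ × ℤ × ℕ)) → ℤ × ℤ × ℤ × ℕ)
      (normE : (ℕ × ℕ) × (ℤ × ℤ × ℤ × ℕ) → ℤ × ℕ)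
      (latScale : (ℕ × ℕ) × ((ℕ × List ℤ) × (ℤ × ℤ × ℤ × ℕ)) → ℕ × List ℤ)
      (latProd : (ℕ × ℕ) × ((ℕ × List ℤ) × (ℕ × List ℤ)) → ℕ × List ℤ)
      (latAddGen : (ℕ × ℕ) × ((ℕ × List ℤ) × (ℤ × ℤ × ℤ × ℕ)) → ℕ × List ℤ),
      CodeFP (pairE (pairE natE natE) (pairE (pairE intE (pairE intE (pairE intE natE))) (pairE intE (pairE intE (pairE intE natE)))))
        (pairE intE (pairE intE (pairE intE natE))) mulE ∧
      CodeFP (pairE (pairE natE natE) (pairE intE (pairE intE (pairE intE natE)))) (pairE intE natE) normE ∧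
      CodeFP (pairE (pairE natE natE) (pairE (pairE natE (rawE intE)) (pairE intE (pairE intE (pairE intE natE)))))
        (pairE natE (rawE intE)) latScale ∧
      CodeFP (pairE (pairE natE natE) (pairE (pairE natE (rawE intE)) (pairE natE (rawE intE)))) (pairE natE (rawE intE)) latProd ∧
      CodeFP (pairE (pairE natE natE) (pairE (pairE natE (rawE intE)) (pairE intE (pairE intE (pairE intE natE)))))
        (pairE natE (rawE intE)) latAddGen ∧
    ∀ (a b : ℕ), Squarefree (a * b) → a * b ≠ 1 →
      ∀ (K : Type) [Field K] [NumberField K], Module.finrank ℚ K = 3 →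
        ∀ θ : K, θ ^ 3 = ((a * b ^ 2 : ℕ) : K) →
        (∀ c₀ c₁ c₂ : ℚ, (c₀ : K) + (c₁ : K) * θ + (c₂ : K) * (θ ^ 2 / (b : K)) = 0 → c₀ = 0 ∧ c₁ = 0 ∧ c₂ = 0) →
        -- multiplication of element codes
        (∀ e₁ e₂ : ℤ × ℤ × ℤ × ℕ, 1 ≤ e₁.2.2.2 → 1 ≤ e₂.2.2.2 →
          1 ≤ (mulE ((a, b), (e₁, e₂))).2.2.2 ∧
          (((((mulE ((a, b), (e₁, e₂))).1 : ℤ) : K) + (((mulE ((a, b), (e₁, e₂))).2.1 : ℤ) : K) * θ + (((mulE ((a, b), (e₁, e₂))).2.2.1 : ℤ) : K) * (θ ^ 2 / (b : K))) /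
              (((mulE ((a, b), (e₁, e₂))).2.2.2 : ℕ) : K)) =
            (((((e₁).1 : ℤ) : K) + (((e₁).2.1 : ℤ) : K) * θ + (((e₁).2.2.1 : ℤ) : K) * (θ ^ 2 / (b : K))) /
              (((e₁).2.2.2 : ℕ) : K)) *
            (((((e₂).1 : ℤ) : K) + (((e₂).2.1 : ℤ) : K) * θ + (((e₂).2.2.1 : ℤ) : K) * (θ ^ 2 / (b : K))) /
              (((e₂).2.2.2 : ℕ) : K))) ∧
        -- the norm of an element code, as numerator/denominator
        (∀ e : ℤ × ℤ × ℤ × ℕ, 1 ≤ e.2.2.2 →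
          1 ≤ (normE ((a, b), e)).2 ∧
          (((normE ((a, b), e)).1 : ℤ) : ℚ) / (((normE ((a, b), e)).2 : ℕ) : ℚ) =
            Algebra.norm ℚ (((((e).1 : ℤ) : K) + (((e).2.1 : ℤ) : K) * θ + (((e).2.2.1 : ℤ) : K) * (θ ^ 2 / (b : K))) /
              (((e).2.2.2 : ℕ) : K))) ∧
        -- canonical codes are unique for a given lattice
        (∀ c c' : ℕ × List ℤ, (∃ (h11 h12 h13 h22 h23 h33 : ℤ), (c).2 = [h11, h12, h13, h22, h23, h33] ∧
            0 < h11 ∧ 0 < h22 ∧ 0 < h33 ∧ 0 ≤ h12 ∧ h12 < h22 ∧ 0 ≤ h13 ∧ h13 < h33 ∧ 0 ≤ h23 ∧ h23 < h33 ∧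
            1 ≤ (c).1 ∧ Int.gcd ((c).1 : ℤ) (Int.gcd h11 (Int.gcd h12 (Int.gcd h13 (Int.gcd h22 (Int.gcd h23 h33))))) = 1) → (∃ (h11 h12 h13 h22 h23 h33 : ℤ), (c').2 = [h11, h12, h13, h22, h23, h33] ∧
            0 < h11 ∧ 0 < h22 ∧ 0 < h33 ∧ 0 ≤ h12 ∧ h12 < h22 ∧ 0 ≤ h13 ∧ h13 < h33 ∧ 0 ≤ h23 ∧ h23 < h33 ∧
            1 ≤ (c').1 ∧ Int.gcd ((c').1 : ℤ) (Int.gcd h11 (Int.gcd h12 (Int.gcd h13 (Int.gcd h22 (Int.gcd h23 h33))))) = 1) →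
          (∀ φ : K, (∃ (h11 h12 h13 h22 h23 h33 u v w : ℤ), (c).2 = [h11, h12, h13, h22, h23, h33] ∧
            (((c).1 : ℕ) : K) * (φ) = ((u * h11 : ℤ) : K) + ((u * h12 + v * h22 : ℤ) : K) * θ +
              ((u * h13 + v * h23 + w * h33 : ℤ) : K) * (θ ^ 2 / (b : K))) ↔ (∃ (h11 h12 h13 h22 h23 h33 u v w : ℤ), (c').2 = [h11, h12, h13, h22, h23, h33] ∧
            (((c').1 : ℕ) : K) * (φ) = ((u * h11 : ℤ) : K) + ((u * h12 + v * h22 : ℤ) : K) * θ +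
              ((u * h13 + v * h23 + w * h33 : ℤ) : K) * (θ ^ 2 / (b : K)))) → c = c') ∧
        -- lattice × nonzero element
        (∀ (c : ℕ × List ℤ) (e : ℤ × ℤ × ℤ × ℕ), (∃ (h11 h12 h13 h22 h23 h33 : ℤ), (c).2 = [h11, h12, h13, h22, h23, h33] ∧
            0 < h11 ∧ 0 < h22 ∧ 0 < h33 ∧ 0 ≤ h12 ∧ h12 < h22 ∧ 0 ≤ h13 ∧ h13 < h33 ∧ 0 ≤ h23 ∧ h23 < h33 ∧
            1 ≤ (c).1 ∧ Int.gcd ((c).1 : ℤ) (Int.gcd h11 (Int.gcd h12 (Int.gcd h13 (Int.gcd h22 (Int.gcd h23 h33))))) = 1) → 1 ≤ e.2.2.2 →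
          (((((e).1 : ℤ) : K) + (((e).2.1 : ℤ) : K) * θ + (((e).2.2.1 : ℤ) : K) * (θ ^ 2 / (b : K))) /
              (((e).2.2.2 : ℕ) : K)) ≠ 0 →
          (∃ (h11 h12 h13 h22 h23 h33 : ℤ), (latScale ((a, b), (c, e))).2 = [h11, h12, h13, h22, h23, h33] ∧
            0 < h11 ∧ 0 < h22 ∧ 0 < h33 ∧ 0 ≤ h12 ∧ h12 < h22 ∧ 0 ≤ h13 ∧ h13 < h33 ∧ 0 ≤ h23 ∧ h23 < h33 ∧
            1 ≤ (latScale ((a, b), (c, e))).1 ∧ Int.gcd ((latScale ((a, b), (c, e))).1 : ℤ) (Int.gcd h11 (Int.gcd h12 (Int.gcd h13 (Int.gcd h22 (Int.gcd h23 h33))))) = 1) ∧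
          ∀ φ : K, (∃ (h11 h12 h13 h22 h23 h33 u v w : ℤ), (latScale ((a, b), (c, e))).2 = [h11, h12, h13, h22, h23, h33] ∧
            (((latScale ((a, b), (c, e))).1 : ℕ) : K) * (φ) = ((u * h11 : ℤ) : K) + ((u * h12 + v * h22 : ℤ) : K) * θ +
              ((u * h13 + v * h23 + w * h33 : ℤ) : K) * (θ ^ 2 / (b : K))) ↔
            ∃ ψ : K, (∃ (h11 h12 h13 h22 h23 h33 u v w : ℤ), (c).2 = [h11, h12, h13, h22, h23, h33] ∧
            (((c).1 : ℕ) : K) * (ψ) = ((u * h11 : ℤ) : K) + ((u * h12 + v * h22 : ℤ) : K) * θ +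
              ((u * h13 + v * h23 + w * h33 : ℤ) : K) * (θ ^ 2 / (b : K))) ∧ φ = ψ * (((((e).1 : ℤ) : K) + (((e).2.1 : ℤ) : K) * θ + (((e).2.2.1 : ℤ) : K) * (θ ^ 2 / (b : K))) /
              (((e).2.2.2 : ℕ) : K))) ∧
        -- lattice × lattice (the ℤ-span of the products)
        (∀ c₁ c₂ : ℕ × List ℤ, (∃ (h11 h12 h13 h22 h23 h33 : ℤ), (c₁).2 = [h11, h12, h13, h22, h23, h33] ∧
            0 < h11 ∧ 0 < h22 ∧ 0 < h33 ∧ 0 ≤ h12 ∧ h12 < h22 ∧ 0 ≤ h13 ∧ h13 < h33 ∧ 0 ≤ h23 ∧ h23 < h33 ∧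
            1 ≤ (c₁).1 ∧ Int.gcd ((c₁).1 : ℤ) (Int.gcd h11 (Int.gcd h12 (Int.gcd h13 (Int.gcd h22 (Int.gcd h23 h33))))) = 1) → (∃ (h11 h12 h13 h22 h23 h33 : ℤ), (c₂).2 = [h11, h12, h13, h22, h23, h33] ∧
            0 < h11 ∧ 0 < h22 ∧ 0 < h33 ∧ 0 ≤ h12 ∧ h12 < h22 ∧ 0 ≤ h13 ∧ h13 < h33 ∧ 0 ≤ h23 ∧ h23 < h33 ∧
            1 ≤ (c₂).1 ∧ Int.gcd ((c₂).1 : ℤ) (Int.gcd h11 (Int.gcd h12 (Int.gcd h13 (Int.gcd h22 (Int.gcd h23 h33))))) = 1) →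
          (∃ (h11 h12 h13 h22 h23 h33 : ℤ), (latProd ((a, b), (c₁, c₂))).2 = [h11, h12, h13, h22, h23, h33] ∧
            0 < h11 ∧ 0 < h22 ∧ 0 < h33 ∧ 0 ≤ h12 ∧ h12 < h22 ∧ 0 ≤ h13 ∧ h13 < h33 ∧ 0 ≤ h23 ∧ h23 < h33 ∧
            1 ≤ (latProd ((a, b), (c₁, c₂))).1 ∧ Int.gcd ((latProd ((a, b), (c₁, c₂))).1 : ℤ) (Int.gcd h11 (Int.gcd h12 (Int.gcd h13 (Int.gcd h22 (Int.gcd h23 h33))))) = 1) ∧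
          ∀ φ : K, (∃ (h11 h12 h13 h22 h23 h33 u v w : ℤ), (latProd ((a, b), (c₁, c₂))).2 = [h11, h12, h13, h22, h23, h33] ∧
            (((latProd ((a, b), (c₁, c₂))).1 : ℕ) : K) * (φ) = ((u * h11 : ℤ) : K) + ((u * h12 + v * h22 : ℤ) : K) * θ +
              ((u * h13 + v * h23 + w * h33 : ℤ) : K) * (θ ^ 2 / (b : K))) ↔
            φ ∈ AddSubgroup.closure {ψ : K | ∃ ψ₁ ψ₂ : K, (∃ (h11 h12 h13 h22 h23 h33 u v w : ℤ), (c₁).2 = [h11, h12, h13, h22, h23, h33] ∧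
            (((c₁).1 : ℕ) : K) * (ψ₁) = ((u * h11 : ℤ) : K) + ((u * h12 + v * h22 : ℤ) : K) * θ +
              ((u * h13 + v * h23 + w * h33 : ℤ) : K) * (θ ^ 2 / (b : K))) ∧ (∃ (h11 h12 h13 h22 h23 h33 u v w : ℤ), (c₂).2 = [h11, h12, h13, h22, h23, h33] ∧
            (((c₂).1 : ℕ) : K) * (ψ₂) = ((u * h11 : ℤ) : K) + ((u * h12 + v * h22 : ℤ) : K) * θ +
              ((u * h13 + v * h23 + w * h33 : ℤ) : K) * (θ ^ 2 / (b : K))) ∧ ψ = ψ₁ * ψ₂}) ∧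
        -- lattice + one generator
        (∀ (c : ℕ × List ℤ) (e : ℤ × ℤ × ℤ × ℕ), (∃ (h11 h12 h13 h22 h23 h33 : ℤ), (c).2 = [h11, h12, h13, h22, h23, h33] ∧
            0 < h11 ∧ 0 < h22 ∧ 0 < h33 ∧ 0 ≤ h12 ∧ h12 < h22 ∧ 0 ≤ h13 ∧ h13 < h33 ∧ 0 ≤ h23 ∧ h23 < h33 ∧
            1 ≤ (c).1 ∧ Int.gcd ((c).1 : ℤ) (Int.gcd h11 (Int.gcd h12 (Int.gcd h13 (Int.gcd h22 (Int.gcd h23 h33))))) = 1) → 1 ≤ e.2.2.2 →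
          (∃ (h11 h12 h13 h22 h23 h33 : ℤ), (latAddGen ((a, b), (c, e))).2 = [h11, h12, h13, h22, h23, h33] ∧
            0 < h11 ∧ 0 < h22 ∧ 0 < h33 ∧ 0 ≤ h12 ∧ h12 < h22 ∧ 0 ≤ h13 ∧ h13 < h33 ∧ 0 ≤ h23 ∧ h23 < h33 ∧
            1 ≤ (latAddGen ((a, b), (c, e))).1 ∧ Int.gcd ((latAddGen ((a, b), (c, e))).1 : ℤ) (Int.gcd h11 (Int.gcd h12 (Int.gcd h13 (Int.gcd h22 (Int.gcd h23 h33))))) = 1) ∧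
          ∀ φ : K, (∃ (h11 h12 h13 h22 h23 h33 u v w : ℤ), (latAddGen ((a, b), (c, e))).2 = [h11, h12, h13, h22, h23, h33] ∧
            (((latAddGen ((a, b), (c, e))).1 : ℕ) : K) * (φ) = ((u * h11 : ℤ) : K) + ((u * h12 + v * h22 : ℤ) : K) * θ +
              ((u * h13 + v * h23 + w * h33 : ℤ) : K) * (θ ^ 2 / (b : K))) ↔
            ∃ (ψ : K) (k : ℤ), (∃ (h11 h12 h13 h22 h23 h33 u v w : ℤ), (c).2 = [h11, h12, h13, h22, h23, h33] ∧
            (((c).1 : ℕ) : K) * (ψ) = ((u * h11 : ℤ) : K) + ((u * h12 + v * h22 : ℤ) : K) * θ +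
              ((u * h13 + v * h23 + w * h33 : ℤ) : K) * (θ ^ 2 / (b : K))) ∧ φ = ψ + (k : K) * (((((e).1 : ℤ) : K) + (((e).2.1 : ℤ) : K) * θ + (((e).2.2.1 : ℤ) : K) * (θ ^ 2 / (b : K))) /
              (((e).2.2.2 : ℕ) : K)))) →
    ∃ lexE : (ℕ × ℕ) × (ℕ × List ℤ) → ℤ × ℤ × ℤ × ℕ,
      CodeFP (pairE (pairE natE natE) (pairE natE (rawE intE))) (pairE intE (pairE intE (pairE intE natE))) lexE ∧
    ∀ (a b : ℕ), Squarefree (a * b) → a * b ≠ 1 →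
      ∀ (K : Type) [Field K] [NumberField K], Module.finrank ℚ K = 3 →
        ∀ θ : K, θ ^ 3 = ((a * b ^ 2 : ℕ) : K) →
        ∀ (σ₁ : K →+* ℝ) (σ₂ : K →+* ℂ), (∃ z : K, starRingEnd ℂ (σ₂ z) ≠ σ₂ z) →
        ∀ c : ℕ × List ℤ, (∃ (h11 h12 h13 h22 h23 h33 : ℤ), (c).2 = [h11, h12, h13, h22, h23, h33] ∧
            0 < h11 ∧ 0 < h22 ∧ 0 < h33 ∧ 0 ≤ h12 ∧ h12 < h22 ∧ 0 ≤ h13 ∧ h13 < h33 ∧ 0 ≤ h23 ∧ h23 < h33 ∧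
            1 ≤ (c).1 ∧ Int.gcd ((c).1 : ℤ) (Int.gcd h11 (Int.gcd h12 (Int.gcd h13 (Int.gcd h22 (Int.gcd h23 h33))))) = 1) →
          (∃ I : FractionalIdeal (𝓞 K)⁰ K, I ≠ 0 ∧ ∀ φ : K, (∃ (h11 h12 h13 h22 h23 h33 u v w : ℤ), (c).2 = [h11, h12, h13, h22, h23, h33] ∧
            (((c).1 : ℕ) : K) * (φ) = ((u * h11 : ℤ) : K) + ((u * h12 + v * h22 : ℤ) : K) * θ +
              ((u * h13 + v * h23 + w * h33 : ℤ) : K) * (θ ^ 2 / (b : K))) ↔ φ ∈ I) →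
          1 ≤ (lexE ((a, b), c)).2.2.2 ∧
          (∃ (h11 h12 h13 h22 h23 h33 u v w : ℤ), (c).2 = [h11, h12, h13, h22, h23, h33] ∧
            (((c).1 : ℕ) : K) * ((((((lexE ((a, b), c)).1 : ℤ) : K) + (((lexE ((a, b), c)).2.1 : ℤ) : K) * θ + (((lexE ((a, b), c)).2.2.1 : ℤ) : K) * (θ ^ 2 / (b : K))) /
              (((lexE ((a, b), c)).2.2.2 : ℕ) : K))) = ((u * h11 : ℤ) : K) + ((u * h12 + v * h22 : ℤ) : K) * θ +
              ((u * h13 + v * h23 + w * h33 : ℤ) : K) * (θ ^ 2 / (b : K))) ∧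
          0 < σ₁ (((((lexE ((a, b), c)).1 : ℤ) : K) + (((lexE ((a, b), c)).2.1 : ℤ) : K) * θ + (((lexE ((a, b), c)).2.2.1 : ℤ) : K) * (θ ^ 2 / (b : K))) /
              (((lexE ((a, b), c)).2.2.2 : ℕ) : K)) ∧
          ‖σ₂ (((((lexE ((a, b), c)).1 : ℤ) : K) + (((lexE ((a, b), c)).2.1 : ℤ) : K) * θ + (((lexE ((a, b), c)).2.2.1 : ℤ) : K) * (θ ^ 2 / (b : K))) /
              (((lexE ((a, b), c)).2.2.2 : ℕ) : K))‖ < 1 ∧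
          ∀ φ : K, (∃ (h11 h12 h13 h22 h23 h33 u v w : ℤ), (c).2 = [h11, h12, h13, h22, h23, h33] ∧
            (((c).1 : ℕ) : K) * (φ) = ((u * h11 : ℤ) : K) + ((u * h12 + v * h22 : ℤ) : K) * θ +
              ((u * h13 + v * h23 + w * h33 : ℤ) : K) * (θ ^ 2 / (b : K))) → 0 < σ₁ φ → ‖σ₂ φ‖ < 1 →
            σ₁ (((((lexE ((a, b), c)).1 : ℤ) : K) + (((lexE ((a, b), c)).2.1 : ℤ) : K) * θ + (((lexE ((a, b), c)).2.2.1 : ℤ) : K) * (θ ^ 2 / (b : K))) /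
              (((lexE ((a, b), c)).2.2.2 : ℕ) : K)) ≤ σ₁ φ := by
  intro _hT _hB hC _hG
  refine ⟨Literature.NumberTheory.CubicFields.PureCubicLexMin.lexE,
    Literature.NumberTheory.CubicFields.PureCubicLexMin.lexE_codeFP, ?_⟩
  intro a b hab hab1 K _ _ hdeg θ hθ σ₁ σ₂ hσ₂ c hc hI
  obtain ⟨I, hI0, hI⟩ := hI
  exact Literature.NumberTheory.CubicFields.PureCubicLexMin.Correctness.lexE_correct hC.1 hC.2 σ₁ σ₂ hdeg hab hab1
    hθ hσ₂ hc hI0 hI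

end Summit.QuantumAdvantage.QuantumAdvantage.Theorems.LinnikCubicClassGroups
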